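import Literature.NumberTheory.Automorphic.RamakrishnanBoxTimes
import Literature.NumberTheory.Automorphic.KimExteriorSquareGL4Descent
import HarnessLib

/-!
# Ramakrishnan (2000), Theorem M in the cuspidal case: §3.7 "Modularity in the general case"
# — `Ramakrishnan2000_boxTimes_cuspidal` from the leaves of its printed proof

Topic `NumberTheory/Automorphic`; namespace `Literature.NumberTheory.Automorphic`. Second sibling
proof file (theorems only: no `sorry`, no definition, no named fact) of
`Literature.NumberTheory.Automorphic.RamakrishnanBoxTimes`, after `RamakrishnanBoxTimesProofs`,
for the named fact `Ramakrishnan2000_boxTimes_cuspidal` — D. Ramakrishnan, *Modularity of the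
Rankin–Selberg `L`-series, and multiplicity one for `SL(2)`*, Ann. of Math. (2) **152** (2000),
45–111 [Ramakrishnan2000], **Theorem M** (§3) for a cuspidal pair `(π, π')` on `GL(2)/F` of
*general type* (neither member dihedral, `π'` not a twist of `π`): a **cuspidal** `Π = π ⊠ π'` on
`GL(4)/F` with `t_{Π,v} = t_{π,v} ⊗ t_{π',v}` almost everywhere.

After `RamakrishnanTheoremMProofs`, `RamakrishnanCuspidalityOnlyIf`, `RamakrishnanTheoremMExistence`
(Lemma 3.1.1: the special types) and `QuadraticSelfTwistClassFieldProofs` (the two renderings of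
"dihedral" agree; `Ramakrishnan2000_theoremM ⟹ Ramakrishnan2000_boxTimes_cuspidal`), this fact is
the apex of the tree's Ramakrishnan cluster: what it asserts is exactly the content of op. cit.
§§3.2–3.7. This file formalises the **architecture of the printed proof of Theorem M in the
general case** — §3.7, "Proof of Theorem M" (preprint `paper:galaxy-pdf-4279542020`, pp. 47–49):
the induction on `r(π) = (ℓ(π), p(π))` over all number fields which reduces the general case to
the good case (§3.5, Theorem 3.5.1: the converse theorem for `GL(4)`) by cyclic base change of
prime degree (Grunwald–Wang, Arthur–Clozel) and the descent criterion of §3.6 (Proposition 3.6.1)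
— in the idiom of `Kim2003_exteriorSquare_GL4.of_leaves` (`KimExteriorSquareGL4Descent`; Kim 2003,
§4.2: "We follow [Ra1] closely" — here [Ra1] itself): the published ingredients of the printed
proof that have no carrier in the tree (converse theorem, triple product `L`-functions, base
change for `GL(2)` and `GL(4)`, Grunwald–Wang) are stated **inline as hypotheses** of the theorems
(no named fact is introduced), each in the tree's Satake-parameter vocabulary, and the fact is
PROVED from them (`Ramakrishnan2000_boxTimes_cuspidal.of_leaves`).

## The printed proof (§3.7, preprint pp. 47–49), verbatim in outline

> "Suppose `r = r(π)` is `(0,1)`. Then, for any quadratic extension `K'` which is totally complex,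
> the assertion holds by Theorem 3.5.1. Also, given any finite place `u`, we can find a totally
> complex, quadratic extension `K'(u)` such that `u` splits in `K'(u)`. Applying the descent
> criterion (Proposition 3.6.1), we can find a common descent having the requisite properties.
> Now let `r > (0, 1)`, and assume by induction that the Theorem is proved (over all number fields
> `K`) for pairs `(π₁, π₂)` […] with `r(π₁, π₂) < r`. […] Enumerate the set of finite places where
> `π` is unramified, and list them as `{v₁, v₂, …, v_j, …}`. […] by the Grunewald–Wang theorem […]
> Let `K_j` be the `p`-extension of `F` cut out by `χ(j)`. By construction we have, for every
> `j ≥ 1`, (3.7.3) `r(π_{K_j}) < r` [preprint: "`r(π) < r`", sic]. Thus, by induction, the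
> Theorem holds for `π_{K_j}` for each `j`. […] Put (3.7.4) `Π_j = π_{K_j} ⊠ π'_{K_j}`. […] Lemma 3.7.5. There exist at most a finite
> number of indices `j` such that `Π_j` is not cuspidal. […] we may assume that `Π_j` is cuspidal
> for every `j`. Next we fix a pair `(j, r)` of indices and consider the descent criterion (DC) of
> Proposition 3.6.1. […] both these local representations correspond to the restriction (to the
> Weil group of `(K_jK_r)_w`) of `σ_v ⊗ σ'_v` […] which gives (DC) by the strong multiplicity one
> theorem. Applying Proposition 3.6.1, we then get a unique cuspidal descent `Π` on `GL(4)/F` such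
> that, for all but a finite number of indices, we have `Π_{K_j} ≃ Π_j`. Finally, by construction,
> each (unramified) finite place `v_j` splits completely in `K_j`; let `w_j` be a divisor of `v_j`
> in `K_j`. This implies (by the definition of base change) that, for almost all `j`, we have
> `L(s, Π_{v_j}) = L(s, (Π_j)_{w_j}) = L(s, (π_{K_j})_w × (π'_{K_j})_w) = L(s, π_v × π'_v)`. […]
> Thus `Π` is a weak (tensor product) lifting of `(π, π')`. By Proposition 3.2.1, it is also the
> strong lifting."

## The leaves (hypotheses; `t_{π,v}` = Satake parameter, `f(w|v)` = residue degree)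

As in `KimExteriorSquareGL4Descent`, the dichotomy "good / not good" and the rank `r(π)` are taken
ABSTRACTLY: the theorems hold for every predicate `Good` on cuspidal pairs and every rank function
`rk` into a type with a well-founded `<` for which the leaves hold; Ramakrishnan's proof supplies
his — `Good` = "`F` totally complex and, at each finite place `v`, either `π_v` or `π'_v` is not
supercuspidal" (§3.5, p. 41), `rk` = `r(π) = (ℓ(π), p(π))` of (3.7.2) ordered lexicographically,
refined by one bit recording whether `F` is totally complex (so that the case `r = (0,1)` over a
field that is not totally complex — handled in the text by the same descent from the totally
complex quadratic extensions `K'(u)` — is an instance of the induction step). "General type" is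
the pair of hypotheses of the fact, verbatim (no a.e. `ε_{K/F}`-self-twist for any quadratic
`K/F`; `t_{π'} ≠ χ(ϖ) t_π` a.e. for every Hecke character `χ`).

* `hGood` — **the good case** (Theorem 3.5.1, p. 41: "For every good pair `(π, π')`, there exists
  an isobaric automorphic representation `π ⊠ π'` of `GL(4, 𝔸_F)` such that the identities `(L_v)`,
  `(ε_v)`, `(L_∞)` asserted in Theorem M hold, where `v` is an arbitrary finite place" — the
  converse theorem for `GL(4)` of Cogdell–Piatetski-Shapiro (Thm. 3.1.3) applied to `Π = ⊗_v Π_v`,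
  its analytic hypotheses supplied by the triple product `L`-functions of §§3.3–3.4 (Garrett,
  Piatetski-Shapiro–Rallis, Ikeda; Shahidi, Kim–Shahidi; boundedness in vertical strips by
  Arthur's truncation on `GSp(6)`), Lemma 3.5.3 (Langlands, *On the notion of an automorphic
  representation*, Prop. 2) and Proposition 3.2.1 — together with the cuspidality criterion of
  Proposition 3.2.1 (pp. 18–21: for `(π, π')` of general type the isobaric `π ⊠ π'` is cuspidal;
  Jacquet–Shalika [JS2] and Gelbart–Jacquet [GJ])): for a good pair of general type over `K` there
  is a CUSPIDAL `P` on `GL₄(𝔸_K)` with `t_{P,v} = t_{π,v} ⊗ t_{π',v}` at EVERY finite place `v` at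
  which `π` and `π'` are unramified (the unramified places of `(L_v)`, (2.2.6)).
* `hStep` — **the family of the induction step** (pp. 47–48, for `(π, π')` not good: the local
  characters `χ_v` at `S''`, the Grunwald–Wang theorem [AT, Ch. 10, Thm. 5], "`K_j` the
  `p`-extension of `F` cut out by `χ(j)`" in which `v_j` splits — `χ(j)_{v_j} = 1` —, (3.7.3)
  `r(π_{K_j}) < r`, base change [AC] (Arthur–Clozel, Ch. 3, Thm. 4.2 (a) and Thm. 5.1: `π_{K_j}` is a
  strong lift, `t_{π_{K_j},w} = t_{π,v}^{f(w|v)}` at every `w ∣ v` with `π_v` unramified, and is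
  cuspidal — "if the automorphic representation `π_{K_j}` is not cuspidal for some `j`, it must be
  dihedral (with `p = 2`), and […] we may assume that we are not in this case"), and Lemma 3.7.5
  with its proof (p. 48: outside a finite set of indices `π_{K_j}` is not dihedral — Gelbart–Jacquet
  and Lemma 3.6.2 — and is not a twist of `π'_{K_j}` — Ikeda's theorem on the poles of triple
  product `L`-functions [Ik1])): given any sequence `(v_j)_{j ∈ ℕ}` of finite places at which `π`
  and `π'` are unramified, there are a prime `p` and, for all `j` outside a finite set of indices,
  pairwise non-isomorphic Galois extensions `K_j/K` of degree `p` in which `v_j` has a divisor `w_j`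
  with `e = f = 1`, together with CUSPIDAL base changes `π_{K_j}, π'_{K_j}` forming a pair of general
  type over `K_j`, with `rk (π_{K_j}, π'_{K_j}) < rk (π, π')`. (Pairwise non-isomorphy of the `K_j`,
  implicit in the proof of Prop. 3.6.1 — "the characters `δ_j^a δ_r^{-b}` are all distinct for
  distinct pairs `(j, r)`" — and explicit in Kim's rendering of the same construction, Kim 2003,
  proof of Thm. 4.2.3, pp. 156–157: "By throwing away finitely many indices, we can assume that
  the `K_j`'s are all different", is part of the leaf; Grunwald–Wang leaves the freedom to choose
  the `K_j` so.)
* `hDescent` — **the descent criterion** (Proposition 3.6.1, pp. 43–46: "Fix `n, p ∈ ℕ` with `p`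
  prime. Let `F` a number field, `{K_j | j ∈ ℕ}` a family of cyclic extensions of `F` with
  `[K_j : F] = p`, and for each `j ∈ ℕ`, `π_j` a cuspidal automorphic representation of
  `GL(n, 𝔸_{K_j})`. Suppose that, for all `j, r ∈ ℕ`, the base changes of `π_j, π_r` to the
  compositum `K_jK_r` satisfy (DC) `(π_j)_{K_jK_r} ≃ (π_r)_{K_jK_r}`. Then there exists a unique
  cuspidal automorphic representation `π` of `GL(n, 𝔸_F)` such that `(π)_{K_j} ≃ π_j`, for all but
  a finite number of `j`"), on Satake parameters: (DC) is rendered as the equality of the Satake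
  parameters of the (virtual) base changes to any common overfield `L` of `K_j, K_r` almost
  everywhere, `t_{π_j,w∩K_j}^{f(w|w∩K_j)} = t_{π_r,w∩K_r}^{f(w|w∩K_r)}` (Arthur–Clozel Ch. 3, (1.1)),
  and the conclusion `(π)_{K_j} ≃ π_j` by its consequence at the places of `K_j` split over `F`:
  `t_{π,v} = t_{π_j,w}` whenever `w ∣ v` has `e(w|v) = f(w|v) = 1` (loc. cit. (1.1) and Thm. 5.1: base
  change is the identity at a split place) — exactly the shape of `hDescent` in
  `KimExteriorSquareGL4Descent`, for cuspidal rather than isobaric families (uniqueness is not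
  asserted).

## What is proved

* `AutomorphicRepData.eventually_hasSatakeParamAt_boxTimesLift_of_baseChange`,
  `AutomorphicRepData.eventually_map_pow_eq_of_boxTimesLift_of_baseChange`,
  `AutomorphicRepData.eventually_descentCondition_of_boxTimesLifts` — **Ramakrishnan's verification
  of (DC)** (p. 48: "by construction, both these local representations correspond to the
  restriction (to the Weil group of `(K_jK_r)_w`) of `σ_v ⊗ σ'_v`"), on Satake parameters: with
  `π_K, π'_K` weak base changes of `π, π'` and `P_K` a weak `⊠`-lift of `(π_K, π'_K)`,
  `t_{P_K,u}^{f(w|u)} = (t_{π,v} ⊗ t_{π',v})^{f(w|v)}` for almost all places `w` of any overfield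
  (`satakeTensor_map_pow`, `Ideal.inertiaDeg_tower`, uniqueness of Satake parameters — Flath), whence
  (DC) for two such towers.
* `Ramakrishnan2000_boxTimes_cuspidal.exists_strongLift_of_leaves` — **Theorem M (cuspidal case) by
  the induction of §3.7**, in the strong form the induction carries: for every cuspidal pair
  `(π, π')` of general type on `GL₂(𝔸_K)` there is a cuspidal `P` on `GL₄(𝔸_K)` with
  `t_{P,v} = t_{π,v} ⊗ t_{π',v}` at EVERY finite place where `π` and `π'` are unramified.
* `Ramakrishnan2000_boxTimes_cuspidal.of_leaves` — the named fact from the three leaves, for any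
  `Good`, `rk`.
* `Ramakrishnan2000_boxTimes_cuspidal.of_leaves'` — the same with Ramakrishnan's own goodness
  predicate (§3.5, p. 41: `K` totally complex — Mathlib `NumberField.IsTotallyComplex` — and at
  each finite place `v` not both `π_v`, `π'_v` supercuspidal, through the tree's local components
  `AutomorphicRepData.HasLocalComponentAt` of `LocalComponentBJ` and Harish-Chandra's
  `Representation.IsSupercuspidal` of `MatrixCoefficients`) and the rank function quantified
  existentially inside `hStep`: three CLOSED hypotheses, each a statement a planner can vendor
  verbatim as a named fact (Thm. 3.5.1 ∧ Prop. 3.2.1; §3.7 pp. 47–48 with Lemma 3.7.5; Prop. 3.6.1).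

## The induction, and one point of rigour

The text's closing step reads off `L(s, Π_{v_j}) = L(s, (Π_j)_{w_j}) = L(s, (π_{K_j})_w × (π'_{K_j})_w)`,
the second equality being `(L_{w_j})` for `Π_j` AT the place `w_j` — available because the
induction hypothesis is Theorem M for `(π_{K_j}, π'_{K_j})` including the strong lifting property
(Prop. 3.2.1 over `K_j`). Accordingly the formal induction carries the STRONG invariant
"`t_{P,v} = t_{π,v} ⊗ t_{π',v}` at every place where `π, π'` are unramified" (supplied in the good
case by `hGood`, i.e. by Thm. 3.5.1 "where `v` is an arbitrary finite place"), and recovers it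
after the descent — which controls `t_{Π,v_j}` only for all but finitely many `j` — by running the
construction with the unramified places enumerated WITH INFINITE MULTIPLICITY
(`exists_enum_infinite_fiber` of `KimExteriorSquareGL4Descent`: every place is `v_j` for infinitely
many `j`, so each escapes the finite exceptional set of indices); the Grunwald–Wang construction
of p. 47 serves verbatim for sequences with repetitions. No use of Prop. 3.2.1 over `F` (weak ⇒
strong) and no strong multiplicity one is then needed at the top level, and cuspidality of `Π`
comes from Prop. 3.6.1 (a descent of cuspidal `Π_j` is cuspidal), as in the text.

Nothing in this file assumes `Ramakrishnan2000_boxTimes_cuspidal` (or `Ramakrishnan2000_theoremM`);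
the leaves `hGood` (converse theorem for `GL(4)` + triple products + Prop. 3.2.1), `hStep`
(Grunwald–Wang, Arthur–Clozel base change for `GL(2)`, Lemma 3.7.5) and `hDescent` (Prop. 3.6.1:
Arthur–Clozel base change for `GL(n)`, Lemma 3.6.2, strong multiplicity one) are exactly what
separates the tree from `Ramakrishnan2000_boxTimes_cuspidal_holds`.

## References

* [Ramakrishnan2000] D. Ramakrishnan, Ann. of Math. (2) 152 (2000), 45–111,
  doi:10.2307/2661379 (preprint `paper:galaxy-pdf-4279542020`): Theorem M (§3); §3.1, Thm. 3.1.3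
  (converse theorem, [CoPS]) and (P1)–(P2) (pp. 14–17); Prop. 3.2.1 (pp. 18–21); §3.5, Thm. 3.5.1,
  Lemmas 3.5.2–3.5.3 (pp. 41–43); §3.6, Prop. 3.6.1, Lemma 3.6.2 (pp. 43–46); §3.7, Lemma 3.7.1,
  (3.7.2)–(3.7.4), Lemma 3.7.5 and the proof of Theorem M (pp. 46–49).
* [Kim2002] H. H. Kim, J. Amer. Math. Soc. 16 (2003), 139–183, §4.2: Prop. 4.2.4–4.2.5 (the
  restatement of Prop. 3.6.1, with Remark 4.2 and Appendix 1) and the proof of Thm. 4.2.3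
  (pp. 156–158, "We follow [Ra1] closely") — `KimExteriorSquareGL4Descent`.
* [ArthurClozelAMS120] J. Arthur, L. Clozel, *Simple algebras, base change, and the advanced theory
  of the trace formula*, Ann. of Math. Stud. 120 (1989), Ch. 3, (1.1), Thm. 4.2, Thm. 5.1.
* J. W. Cogdell, I. I. Piatetski-Shapiro, *Converse theorems for `GL_n`*, Publ. Math. IHÉS 79
  (1994) and *A converse theorem for `GL₄`*, Math. Res. Lett. 3 (1996) ("[CoPS]"; no bib key, not
  cited by a declaration).
* E. Artin, J. Tate, *Class field theory*, Ch. 10, Thm. 5 (Grunwald–Wang; "[AT]"; no bib key).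
* D. Flath, *Decomposition of representations into tensor products*, Corvallis 1979, Thm. 3
  (uniqueness of Satake parameters, `AutomorphicRepData.hasSatakeParamAt_unique_holds`).
-/

noncomputable section

open scoped NumberField Classical MatrixGroups
open NumberField IsDedekindDomain Filter

namespace Literature.NumberTheory.Automorphic

/-! ### (DC) for `⊠` on Satake parameters (§3.7, p. 48) -/

section DescentCondition

variable {F K L : Type} [Field F] [NumberField F] [Field K] [NumberField K] [Field L]
  [NumberField L] [Algebra F K] [Algebra F L] [Algebra K L] [IsScalarTower F K L]
  {hF2 : isCompact_glFiniteIntegralLevel 2 F} {hK2 : isCompact_glFiniteIntegralLevel 2 K}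
  {hK4 : isCompact_glFiniteIntegralLevel 4 K}

/-- **`⊠` after base change.** If `π_K, π'_K` are weak base changes of `π, π'` to `K`
(`t_{π_K,u} = t_{π,v}^{f(u|v)}`) and `P_K` is a weak `⊠`-lift of `(π_K, π'_K)` over `K`, then for
almost all `u`: `t_{P_K,u} = t_{π,v}^{f} ⊗ t_{π',v}^{f} = (t_{π,v} ⊗ t_{π',v})^{f}`
(`satakeTensor_map_pow`, Arthur–Clozel Ch. 3 (1.1)). [cite: Ramakrishnan2000, §3.7, proof of Thm. M (preprint p. 48)] -/
theorem AutomorphicRepData.eventually_hasSatakeParamAt_boxTimesLift_of_baseChange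
    (π π' : AutomorphicRepData (AutomorphyDatum.gl 2 F hF2))
    (πK π'K : AutomorphicRepData (AutomorphyDatum.gl 2 K hK2))
    (PK : AutomorphicRepData (AutomorphyDatum.gl 4 K hK4))
    (hπK : ∀ᶠ u : HeightOneSpectrum (𝓞 K) in cofinite,
      ∀ (v : HeightOneSpectrum (𝓞 F)) (α : Multiset ℂ), u.asIdeal.under (𝓞 F) = v.asIdeal →
        π.HasSatakeParamAt v α → πK.HasSatakeParamAt u (α.map (· ^ u.asIdeal.inertiaDeg (𝓞 F))))
    (hπ'K : ∀ᶠ u : HeightOneSpectrum (𝓞 K) in cofinite,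
      ∀ (v : HeightOneSpectrum (𝓞 F)) (β : Multiset ℂ), u.asIdeal.under (𝓞 F) = v.asIdeal →
        π'.HasSatakeParamAt v β → π'K.HasSatakeParamAt u (β.map (· ^ u.asIdeal.inertiaDeg (𝓞 F))))
    (hPK : ∀ᶠ u : HeightOneSpectrum (𝓞 K) in cofinite, ∀ α β : Multiset ℂ,
      πK.HasSatakeParamAt u α → π'K.HasSatakeParamAt u β →
        PK.HasSatakeParamAt u (satakeTensor α β)) :
    ∀ᶠ u : HeightOneSpectrum (𝓞 K) in cofinite,
      ∀ (v : HeightOneSpectrum (𝓞 F)) (α β : Multiset ℂ), u.asIdeal.under (𝓞 F) = v.asIdeal →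
        π.HasSatakeParamAt v α → π'.HasSatakeParamAt v β →
          PK.HasSatakeParamAt u ((satakeTensor α β).map (· ^ u.asIdeal.inertiaDeg (𝓞 F))) := by
  filter_upwards [hπK, hπ'K, hPK] with u h₁ h₂ h₃ v α β hv hα hβ
  rw [← satakeTensor_map_pow]
  exact h₃ _ _ (h₁ v α hv hα) (h₂ v β hv hβ)

/-- **The Satake parameters of `Π_j` seen from the compositum.** With `π_K, π'_K, P_K` as in
`eventually_hasSatakeParamAt_boxTimesLift_of_baseChange`, for almost all finite places `w` of an
overfield `L ⊇ K ⊇ F`: if `γ` is the Satake parameter of `P_K` at `u = w ∩ K`, then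
`γ^{f(w|u)} = (t_{π,v} ⊗ t_{π',v})^{f(w|v)}`, `v = w ∩ F` (`f(w|v) = f(w|u) f(u|v)`, Mathlib
`Ideal.inertiaDeg_tower`; uniqueness of Satake parameters, Flath) — "both these local
representations correspond to the restriction (to the Weil group of `(K_jK_r)_w`) of
`σ_v ⊗ σ'_v`" (op. cit. p. 48). [cite: Ramakrishnan2000, §3.7, proof of Thm. M (preprint p. 48)] -/
theorem AutomorphicRepData.eventually_map_pow_eq_of_boxTimesLift_of_baseChange
    (π π' : AutomorphicRepData (AutomorphyDatum.gl 2 F hF2))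
    (πK π'K : AutomorphicRepData (AutomorphyDatum.gl 2 K hK2))
    (PK : AutomorphicRepData (AutomorphyDatum.gl 4 K hK4))
    (hπK : ∀ᶠ u : HeightOneSpectrum (𝓞 K) in cofinite,
      ∀ (v : HeightOneSpectrum (𝓞 F)) (α : Multiset ℂ), u.asIdeal.under (𝓞 F) = v.asIdeal →
        π.HasSatakeParamAt v α → πK.HasSatakeParamAt u (α.map (· ^ u.asIdeal.inertiaDeg (𝓞 F))))
    (hπ'K : ∀ᶠ u : HeightOneSpectrum (𝓞 K) in cofinite,
      ∀ (v : HeightOneSpectrum (𝓞 F)) (β : Multiset ℂ), u.asIdeal.under (𝓞 F) = v.asIdeal →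
        π'.HasSatakeParamAt v β → π'K.HasSatakeParamAt u (β.map (· ^ u.asIdeal.inertiaDeg (𝓞 F))))
    (hPK : ∀ᶠ u : HeightOneSpectrum (𝓞 K) in cofinite, ∀ α β : Multiset ℂ,
      πK.HasSatakeParamAt u α → π'K.HasSatakeParamAt u β →
        PK.HasSatakeParamAt u (satakeTensor α β)) :
    ∀ᶠ w : HeightOneSpectrum (𝓞 L) in cofinite,
      ∀ (v : HeightOneSpectrum (𝓞 F)) (α β γ : Multiset ℂ), w.asIdeal.under (𝓞 F) = v.asIdeal →
        π.HasSatakeParamAt v α → π'.HasSatakeParamAt v β →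
          PK.HasSatakeParamAt (w.under (𝓞 K)) γ →
            γ.map (· ^ w.asIdeal.inertiaDeg (𝓞 K)) =
              (satakeTensor α β).map (· ^ w.asIdeal.inertiaDeg (𝓞 F)) := by
  have h1 := AutomorphicRepData.eventually_hasSatakeParamAt_boxTimesLift_of_baseChange
    π π' πK π'K PK hπK hπ'K hPK
  filter_upwards [eventually_cofinite_forall_under_eq (E := L) h1] with w h1 v α β γ hv hα hβ hγ
  have huv : (w.under (𝓞 K)).asIdeal.under (𝓞 F) = v.asIdeal := by
    rw [← hv, HeightOneSpectrum.under_asIdeal, Ideal.under_under]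
  have hγ' := h1 (w.under (𝓞 K)) rfl v α β huv hα hβ
  have e : γ = (satakeTensor α β).map (· ^ (w.under (𝓞 K)).asIdeal.inertiaDeg (𝓞 F)) :=
    PK.hasSatakeParamAt_unique_holds hγ hγ'
  rw [e, Multiset.map_map]
  refine Multiset.map_congr rfl fun x _ => ?_
  haveI : w.asIdeal.LiesOver (w.under (𝓞 K)).asIdeal := ⟨rfl⟩
  rw [Function.comp_apply, ← pow_mul, ← Ideal.inertiaDeg_tower]

/-- **Ramakrishnan's descent condition (DC), verified on Satake parameters** (§3.7, pp. 48–49).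
Let `π, π'` be automorphic on `GL₂(𝔸_F)`; let `K, K'` be two extensions of `F` inside a common
overfield `L`, `π_K, π'_K` and `π_{K'}, π'_{K'}` weak base changes of `π, π'` to `K` and to `K'`,
and `P_K`, `P_{K'}` weak `⊠`-lifts of `(π_K, π'_K)` and `(π_{K'}, π'_{K'})`. Then the (virtual)
base changes of `P_K` and `P_{K'}` to `L` have the same Satake parameters almost everywhere: for
almost all finite places `w` of `L`, if `β` is the parameter of `P_K` at `w ∩ K` and `γ` that of
`P_{K'}` at `w ∩ K'`, then `β^{f(w|w∩K)} = γ^{f(w|w∩K')}` (both are `(t_{π,v} ⊗ t_{π',v})^{f(w|v)}`,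
`v = w ∩ F`). Ramakrishnan: "This leads to the identity `L^Y(s, (Π_j)_{K_jK_r}) = L^Y(s, (Π_r)_{K_jK_r})`
for a large enough finite set `Y` of places, which gives (DC) by the strong multiplicity one
theorem" — the Satake-parameter content of that sentence; strong multiplicity one is not
asserted. [cite: Ramakrishnan2000, §3.7, proof of Thm. M (preprint pp. 48–49)] -/
theorem AutomorphicRepData.eventually_descentCondition_of_boxTimesLifts
    {K' : Type} [Field K'] [NumberField K'] [Algebra F K'] [Algebra K' L] [IsScalarTower F K' L]
    {hK'2 : isCompact_glFiniteIntegralLevel 2 K'} {hK'4 : isCompact_glFiniteIntegralLevel 4 K'}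
    (π π' : AutomorphicRepData (AutomorphyDatum.gl 2 F hF2))
    (πK π'K : AutomorphicRepData (AutomorphyDatum.gl 2 K hK2))
    (PK : AutomorphicRepData (AutomorphyDatum.gl 4 K hK4))
    (πK' π'K' : AutomorphicRepData (AutomorphyDatum.gl 2 K' hK'2))
    (PK' : AutomorphicRepData (AutomorphyDatum.gl 4 K' hK'4))
    (hπK : ∀ᶠ u : HeightOneSpectrum (𝓞 K) in cofinite,
      ∀ (v : HeightOneSpectrum (𝓞 F)) (α : Multiset ℂ), u.asIdeal.under (𝓞 F) = v.asIdeal →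
        π.HasSatakeParamAt v α → πK.HasSatakeParamAt u (α.map (· ^ u.asIdeal.inertiaDeg (𝓞 F))))
    (hπ'K : ∀ᶠ u : HeightOneSpectrum (𝓞 K) in cofinite,
      ∀ (v : HeightOneSpectrum (𝓞 F)) (β : Multiset ℂ), u.asIdeal.under (𝓞 F) = v.asIdeal →
        π'.HasSatakeParamAt v β → π'K.HasSatakeParamAt u (β.map (· ^ u.asIdeal.inertiaDeg (𝓞 F))))
    (hPK : ∀ᶠ u : HeightOneSpectrum (𝓞 K) in cofinite, ∀ α β : Multiset ℂ,
      πK.HasSatakeParamAt u α → π'K.HasSatakeParamAt u β →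
        PK.HasSatakeParamAt u (satakeTensor α β))
    (hπK' : ∀ᶠ u : HeightOneSpectrum (𝓞 K') in cofinite,
      ∀ (v : HeightOneSpectrum (𝓞 F)) (α : Multiset ℂ), u.asIdeal.under (𝓞 F) = v.asIdeal →
        π.HasSatakeParamAt v α → πK'.HasSatakeParamAt u (α.map (· ^ u.asIdeal.inertiaDeg (𝓞 F))))
    (hπ'K' : ∀ᶠ u : HeightOneSpectrum (𝓞 K') in cofinite,
      ∀ (v : HeightOneSpectrum (𝓞 F)) (β : Multiset ℂ), u.asIdeal.under (𝓞 F) = v.asIdeal →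
        π'.HasSatakeParamAt v β →
          π'K'.HasSatakeParamAt u (β.map (· ^ u.asIdeal.inertiaDeg (𝓞 F))))
    (hPK' : ∀ᶠ u : HeightOneSpectrum (𝓞 K') in cofinite, ∀ α β : Multiset ℂ,
      πK'.HasSatakeParamAt u α → π'K'.HasSatakeParamAt u β →
        PK'.HasSatakeParamAt u (satakeTensor α β)) :
    ∀ᶠ w : HeightOneSpectrum (𝓞 L) in cofinite, ∀ β γ : Multiset ℂ,
      PK.HasSatakeParamAt (w.under (𝓞 K)) β → PK'.HasSatakeParamAt (w.under (𝓞 K')) γ →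
        β.map (· ^ w.asIdeal.inertiaDeg (𝓞 K)) = γ.map (· ^ w.asIdeal.inertiaDeg (𝓞 K')) := by
  have h1 := AutomorphicRepData.eventually_map_pow_eq_of_boxTimesLift_of_baseChange
    (L := L) π π' πK π'K PK hπK hπ'K hPK
  have h2 := AutomorphicRepData.eventually_map_pow_eq_of_boxTimesLift_of_baseChange
    (L := L) π π' πK' π'K' PK' hπK' hπ'K' hPK'
  have hπ := eventually_cofinite_forall_under_eq (E := L) π.hasSatakeParamAt_cofinite_holds
  have hπ' := eventually_cofinite_forall_under_eq (E := L) π'.hasSatakeParamAt_cofinite_holds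
  filter_upwards [h1, h2, hπ, hπ'] with w h1 h2 hπ hπ' β γ hβ hγ
  have hv : w.asIdeal.under (𝓞 F) = (w.under (𝓞 F)).asIdeal := rfl
  obtain ⟨α, hα⟩ := hπ _ hv
  obtain ⟨α', hα'⟩ := hπ' _ hv
  rw [h1 _ α α' β hv hα hα' hβ, h2 _ α α' γ hv hα hα' hγ]

end DescentCondition

/-! ### Theorem M (cuspidal case) from the leaves of §3.5–3.7 -/

section Leaves

variable {ρ : Type} [LT ρ] [WellFoundedLT ρ]
  (Good : ∀ (K : Type) [Field K] [NumberField K] (hK2 : isCompact_glFiniteIntegralLevel 2 K),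
    CuspidalAutomorphicRepData 2 K hK2 → CuspidalAutomorphicRepData 2 K hK2 → Prop)
  (rk : ∀ (K : Type) [Field K] [NumberField K] (hK2 : isCompact_glFiniteIntegralLevel 2 K),
    CuspidalAutomorphicRepData 2 K hK2 → CuspidalAutomorphicRepData 2 K hK2 → ρ)

variable
  /- `hGood`: Thm. 3.5.1 (the good case: converse theorem for `GL(4)` [CoPS] fed by the triple
  product `L`-functions of §§3.3–3.4) with Prop. 3.2.1 (weak ⇒ strong lifting, and the cuspidality
  criterion): for a good pair of general type, a CUSPIDAL `Π` with `(L_v)` at every finite `v`. -/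
  (hGood : ∀ (K : Type) [Field K] [NumberField K] (hK2 : isCompact_glFiniteIntegralLevel 2 K)
    (hK4 : isCompact_glFiniteIntegralLevel 4 K) (π π' : CuspidalAutomorphicRepData 2 K hK2),
    (∀ (E : Type) [Field E] [NumberField E] [Algebra K E], Module.finrank K E = 2 →
        ¬ IsQuadraticSelfTwistAE E π.1 ∧ ¬ IsQuadraticSelfTwistAE E π'.1) →
    (∀ χ : GaloisRepresentations.HeckeCharacter K,
        ¬ ∀ᶠ v : HeightOneSpectrum (𝓞 K) in cofinite, ∀ α β : Multiset ℂ,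
            π.1.HasSatakeParamAt v α → π'.1.HasSatakeParamAt v β →
              β = α.map (χ.valueAtUniformizer v * ·)) →
    Good K hK2 π π' →
      ∃ P : CuspidalAutomorphicRepData 4 K hK4,
        ∀ (v : HeightOneSpectrum (𝓞 K)) (α β : Multiset ℂ), π.1.HasSatakeParamAt v α →
          π'.1.HasSatakeParamAt v β → P.1.HasSatakeParamAt v (satakeTensor α β))
  /- `hStep`: §3.7, pp. 47–48 (Grunwald–Wang [AT, Ch. 10, Thm. 5]; (3.7.3) `r(π_{K_j}) < r`;
  Arthur–Clozel base change, Thm. 4.2 (a) / 5.1 of Ch. 3; "if `π_{K_j}` is not cuspidal … it must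
  be dihedral … we may assume that we are not in this case"; Lemma 3.7.5: `(π_{K_j}, π'_{K_j})` is
  of general type for all `j` outside a finite set): the fields `K_j`, the cuspidal base changes
  with `r < r(π)`, and the split places `w_j ∣ v_j`. -/
  (hStep : ∀ (K : Type) [Field K] [NumberField K] (hK2 : isCompact_glFiniteIntegralLevel 2 K)
    (π π' : CuspidalAutomorphicRepData 2 K hK2),
    (∀ (E : Type) [Field E] [NumberField E] [Algebra K E], Module.finrank K E = 2 →
        ¬ IsQuadraticSelfTwistAE E π.1 ∧ ¬ IsQuadraticSelfTwistAE E π'.1) →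
    (∀ χ : GaloisRepresentations.HeckeCharacter K,
        ¬ ∀ᶠ v : HeightOneSpectrum (𝓞 K) in cofinite, ∀ α β : Multiset ℂ,
            π.1.HasSatakeParamAt v α → π'.1.HasSatakeParamAt v β →
              β = α.map (χ.valueAtUniformizer v * ·)) →
    ¬ Good K hK2 π π' →
    ∀ v : ℕ → HeightOneSpectrum (𝓞 K),
      (∀ j, π.1.IsUnramifiedAt (v j) ∧ π'.1.IsUnramifiedAt (v j)) →
    ∃ (p : ℕ) (J : Set ℕ) (E : J → Type) (_ : ∀ j, Field (E j)) (_ : ∀ j, NumberField (E j))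
      (_ : ∀ j, Algebra K (E j)) (hE2 : ∀ j : J, isCompact_glFiniteIntegralLevel 2 (E j))
      (πE π'E : ∀ j : J, CuspidalAutomorphicRepData 2 (E j) (hE2 j)),
      p.Prime ∧ Jᶜ.Finite ∧ (∀ j, IsGalois K (E j)) ∧ (∀ j, Module.finrank K (E j) = p) ∧
      (∀ j r, j ≠ r → IsEmpty (E j ≃ₐ[K] E r)) ∧
      (∀ j, rk (E j) (hE2 j) (πE j) (π'E j) < rk K hK2 π π') ∧
      (∀ (j : J) (E' : Type) [Field E'] [NumberField E'] [Algebra (E j) E'],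
        Module.finrank (E j) E' = 2 →
          ¬ IsQuadraticSelfTwistAE E' (πE j).1 ∧ ¬ IsQuadraticSelfTwistAE E' (π'E j).1) ∧
      (∀ (j : J) (χ : GaloisRepresentations.HeckeCharacter (E j)),
        ¬ ∀ᶠ w : HeightOneSpectrum (𝓞 (E j)) in cofinite, ∀ α β : Multiset ℂ,
            (πE j).1.HasSatakeParamAt w α → (π'E j).1.HasSatakeParamAt w β →
              β = α.map (χ.valueAtUniformizer w * ·)) ∧
      (∀ (j : J) (w : HeightOneSpectrum (𝓞 (E j))) (u : HeightOneSpectrum (𝓞 K)) (α : Multiset ℂ),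
        w.asIdeal.under (𝓞 K) = u.asIdeal → π.1.HasSatakeParamAt u α →
          (πE j).1.HasSatakeParamAt w (α.map (· ^ w.asIdeal.inertiaDeg (𝓞 K)))) ∧
      (∀ (j : J) (w : HeightOneSpectrum (𝓞 (E j))) (u : HeightOneSpectrum (𝓞 K)) (β : Multiset ℂ),
        w.asIdeal.under (𝓞 K) = u.asIdeal → π'.1.HasSatakeParamAt u β →
          (π'E j).1.HasSatakeParamAt w (β.map (· ^ w.asIdeal.inertiaDeg (𝓞 K)))) ∧
      (∀ j : J, ∃ w : HeightOneSpectrum (𝓞 (E j)), w.asIdeal.under (𝓞 K) = (v j).asIdeal ∧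
        w.asIdeal.inertiaDeg (𝓞 K) = 1 ∧ w.asIdeal.ramificationIdx (𝓞 K) = 1))
  /- `hDescent`: Prop. 3.6.1 (descent along a family of cyclic extensions of prime degree, for
  CUSPIDAL `π_j` under (DC); the conclusion `(π)_{K_j} ≃ π_j` for all but finitely many `j` is
  rendered at the places of `K_j` split over `F`, Arthur–Clozel Ch. 3, (1.1), Thm. 5.1). -/
  (hDescent : ∀ (F : Type) [Field F] [NumberField F] (n : ℕ)
    (hFn : isCompact_glFiniteIntegralLevel n F) (p : ℕ), p.Prime →
    ∀ (ι : Type) [Countable ι] [Infinite ι] (K : ι → Type) [∀ j, Field (K j)]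
      [∀ j, NumberField (K j)] [∀ j, Algebra F (K j)],
      (∀ j, IsGalois F (K j)) → (∀ j, Module.finrank F (K j) = p) →
      (∀ j r, j ≠ r → IsEmpty (K j ≃ₐ[F] K r)) →
    ∀ (hK : ∀ j : ι, isCompact_glFiniteIntegralLevel n (K j))
      (Q : ∀ j, CuspidalAutomorphicRepData n (K j) (hK j)),
      (∀ (j r : ι) (L : Type) [Field L] [NumberField L] [Algebra F L] [Algebra (K j) L]
          [Algebra (K r) L] [IsScalarTower F (K j) L] [IsScalarTower F (K r) L],
        ∀ᶠ w : HeightOneSpectrum (𝓞 L) in cofinite, ∀ β γ : Multiset ℂ,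
          (Q j).1.HasSatakeParamAt (w.under (𝓞 (K j))) β →
            (Q r).1.HasSatakeParamAt (w.under (𝓞 (K r))) γ →
              β.map (· ^ w.asIdeal.inertiaDeg (𝓞 (K j))) =
                γ.map (· ^ w.asIdeal.inertiaDeg (𝓞 (K r)))) →
      ∃ P : CuspidalAutomorphicRepData n F hFn,
        ∀ᶠ j : ι in cofinite, ∀ (w : HeightOneSpectrum (𝓞 (K j))) (v : HeightOneSpectrum (𝓞 F)),
          w.asIdeal.under (𝓞 F) = v.asIdeal → w.asIdeal.inertiaDeg (𝓞 F) = 1 →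
            w.asIdeal.ramificationIdx (𝓞 F) = 1 →
              ∀ β : Multiset ℂ, (Q j).1.HasSatakeParamAt w β → P.1.HasSatakeParamAt v β)

include hGood hStep hDescent in
/-- **Ramakrishnan 2000, Theorem M in the cuspidal case, by the induction of §3.7 (preprint
pp. 47–49) — from the leaves, strong form.** Grant: the good case (`hGood` — Thm. 3.5.1: the
converse theorem for `GL(4)` with the triple product `L`-functions of §§3.3–3.4, and Prop. 3.2.1),
the family of the induction step (`hStep` — Grunwald–Wang, (3.7.3) `r(π_{K_j}) < r`, cuspidal base
change of Arthur–Clozel, Lemma 3.7.5, split places `w_j ∣ v_j`) and the descent criterion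
(`hDescent` — Prop. 3.6.1), for an arbitrary goodness predicate `Good` and rank function `rk` into
a well-founded order. Then for every cuspidal pair `(π, π')` on `GL₂(𝔸_K)` of general type (no a.e.
`ε_{E/K}`-self-twist for any quadratic `E/K`; `π'` not an a.e. twist `π ⊗ χ`) there is a CUSPIDAL
`P` on `GL₄(𝔸_K)` with `t_{P,v} = t_{π,v} ⊗ t_{π',v}` at every finite place `v` at which `π` and `π'`
are unramified. Proof: well-founded induction on `rk (π, π')` over all number fields; good pairs:
`hGood`; otherwise enumerate the places where `π, π'` are unramified with infinite multiplicity
(`exists_enum_infinite_fiber`), take the family of `hStep`, the cuspidal `Π_j = π_{K_j} ⊠ π'_{K_j}`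
(induction hypothesis, (3.7.4)), verify (DC) (`AutomorphicRepData.eventually_descentCondition_of_boxTimesLifts`),
descend (`hDescent`), and read off `t_{Π,v_j} = t_{Π_j,w_j} = t_{π_{K_j},w_j} ⊗ t_{π'_{K_j},w_j} =
t_{π,v_j} ⊗ t_{π',v_j}` for all but finitely many `j`, i.e. at every unramified place (module
docstring, "one point of rigour").
[cite: Ramakrishnan2000, Theorem M, proof in §3.7 (preprint pp. 47–49), with Thm. 3.5.1, Prop. 3.6.1, Prop. 3.2.1] -/
theorem Ramakrishnan2000_boxTimes_cuspidal.exists_strongLift_of_leaves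
    (K : Type) [Field K] [NumberField K] (hK2 : isCompact_glFiniteIntegralLevel 2 K)
    (hK4 : isCompact_glFiniteIntegralLevel 4 K) (π π' : CuspidalAutomorphicRepData 2 K hK2)
    (hdih : ∀ (E : Type) [Field E] [NumberField E] [Algebra K E], Module.finrank K E = 2 →
        ¬ IsQuadraticSelfTwistAE E π.1 ∧ ¬ IsQuadraticSelfTwistAE E π'.1)
    (htw : ∀ χ : GaloisRepresentations.HeckeCharacter K,
        ¬ ∀ᶠ v : HeightOneSpectrum (𝓞 K) in cofinite, ∀ α β : Multiset ℂ,
            π.1.HasSatakeParamAt v α → π'.1.HasSatakeParamAt v β →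
              β = α.map (χ.valueAtUniformizer v * ·)) :
    ∃ P : CuspidalAutomorphicRepData 4 K hK4,
      ∀ (v : HeightOneSpectrum (𝓞 K)) (α β : Multiset ℂ), π.1.HasSatakeParamAt v α →
        π'.1.HasSatakeParamAt v β → P.1.HasSatakeParamAt v (satakeTensor α β) := by
  -- well-founded induction on `rk π π'`, over all number fields
  suffices h : ∀ (r : ρ) (K : Type) [Field K] [NumberField K]
      (hK2 : isCompact_glFiniteIntegralLevel 2 K) (hK4 : isCompact_glFiniteIntegralLevel 4 K)
      (π π' : CuspidalAutomorphicRepData 2 K hK2),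
      (∀ (E : Type) [Field E] [NumberField E] [Algebra K E], Module.finrank K E = 2 →
        ¬ IsQuadraticSelfTwistAE E π.1 ∧ ¬ IsQuadraticSelfTwistAE E π'.1) →
      (∀ χ : GaloisRepresentations.HeckeCharacter K,
        ¬ ∀ᶠ v : HeightOneSpectrum (𝓞 K) in cofinite, ∀ α β : Multiset ℂ,
            π.1.HasSatakeParamAt v α → π'.1.HasSatakeParamAt v β →
              β = α.map (χ.valueAtUniformizer v * ·)) →
      rk K hK2 π π' = r →
      ∃ P : CuspidalAutomorphicRepData 4 K hK4,
        ∀ (v : HeightOneSpectrum (𝓞 K)) (α β : Multiset ℂ), π.1.HasSatakeParamAt v α →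
          π'.1.HasSatakeParamAt v β → P.1.HasSatakeParamAt v (satakeTensor α β) from
    h _ K hK2 hK4 π π' hdih htw rfl
  intro r
  induction r using WellFoundedLT.induction with | ind r ih
  intro K _ _ hK2 hK4 π π' hdih htw hr
  by_cases hg : Good K hK2 π π'
  · -- the good case: Thm. 3.5.1 with Prop. 3.2.1
    exact hGood K hK2 hK4 π π' hdih htw hg
  · /- the general case (§3.7): enumerate the places where `π` and `π'` are unramified, with
    infinite multiplicity; base change along the family of `hStep`; `⊠` over `K_j` by induction;
    verify (DC); descend (Prop. 3.6.1); read off `t_{Π,v_j} = t_{Π_j,w_j}` at the split `w_j`. -/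
    haveI := infinite_heightOneSpectrum K
    haveI : Countable (HeightOneSpectrum (𝓞 K)) := countable_heightOneSpectrum K
    have hcof : ∀ᶠ v : HeightOneSpectrum (𝓞 K) in cofinite,
        π.1.IsUnramifiedAt v ∧ π'.1.IsUnramifiedAt v :=
      (π.1.hasSatakeParamAt_cofinite_holds).and π'.1.hasSatakeParamAt_cofinite_holds
    obtain ⟨u₁, hu₁⟩ := hcof.exists
    obtain ⟨e, he, hfib⟩ := exists_enum_infinite_fiber
      (s := {v | π.1.IsUnramifiedAt v ∧ π'.1.IsUnramifiedAt v}) ⟨u₁, hu₁⟩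
    obtain ⟨p, J, E, _, _, _, hE2, πE, π'E, hp, hJ, hGal, hdeg, hdist, hrk, hdihE, htwE, hBC, hBC',
      hsplit⟩ := hStep K hK2 π π' hdih htw hg e he
    choose w hw using hsplit
    have hE4 : ∀ j : J, isCompact_glFiniteIntegralLevel 4 (E j) :=
      fun j => isCompact_glFiniteIntegralLevel_holds 4 (E j)
    -- the induction hypothesis over `K_j`: a cuspidal `Π_j = π_{K_j} ⊠ π'_{K_j}`, strong lift
    have ih' : ∀ j : J, ∃ Q : CuspidalAutomorphicRepData 4 (E j) (hE4 j),
        ∀ (x : HeightOneSpectrum (𝓞 (E j))) (α β : Multiset ℂ), (πE j).1.HasSatakeParamAt x α →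
          (π'E j).1.HasSatakeParamAt x β → Q.1.HasSatakeParamAt x (satakeTensor α β) :=
      fun j => ih _ ((hrk j).trans_eq hr) (E j) (hE2 j) (hE4 j) (πE j) (π'E j) (hdihE j) (htwE j)
        rfl
    choose Q hQ using ih'
    haveI : Infinite J := Set.infinite_coe_iff.mpr (by simpa using hJ.infinite_compl)
    -- descent (Prop. 3.6.1), (DC) being verified on Satake parameters
    obtain ⟨P, hP⟩ := hDescent K 4 hK4 p hp J E hGal hdeg hdist hE4 Q
      (fun j r L _ _ _ _ _ _ _ =>
        AutomorphicRepData.eventually_descentCondition_of_boxTimesLifts π.1 π'.1 (πE j).1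
          (π'E j).1 (Q j).1 (πE r).1 (π'E r).1 (Q r).1 (Eventually.of_forall (hBC j))
          (Eventually.of_forall (hBC' j)) (Eventually.of_forall (hQ j))
          (Eventually.of_forall (hBC r)) (Eventually.of_forall (hBC' r))
          (Eventually.of_forall (hQ r)))
    rw [Filter.eventually_cofinite] at hP
    -- the descended cuspidal `P` is exact at EVERY place where `π` and `π'` are unramified
    refine ⟨P, fun u' α β hα hβ => ?_⟩
    by_contra hcon
    refine hfib u' ⟨⟨α, hα⟩, ⟨β, hβ⟩⟩ (((hP.image Subtype.val).union hJ).subset fun j hj => ?_)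
    have hj' : e j = u' := hj
    by_cases hjJ : j ∈ J
    · refine Or.inl ⟨⟨j, hjJ⟩, fun hgood => hcon ?_, rfl⟩
      have hwu : (w ⟨j, hjJ⟩).asIdeal.under (𝓞 K) = u'.asIdeal := by
        rw [(hw ⟨j, hjJ⟩).1, ← hj']
      have h1 : (πE ⟨j, hjJ⟩).1.HasSatakeParamAt (w ⟨j, hjJ⟩) α := by
        simpa [(hw ⟨j, hjJ⟩).2.1] using hBC ⟨j, hjJ⟩ (w ⟨j, hjJ⟩) u' α hwu hα
      have h2 : (π'E ⟨j, hjJ⟩).1.HasSatakeParamAt (w ⟨j, hjJ⟩) β := by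
        simpa [(hw ⟨j, hjJ⟩).2.1] using hBC' ⟨j, hjJ⟩ (w ⟨j, hjJ⟩) u' β hwu hβ
      exact hgood (w ⟨j, hjJ⟩) u' hwu (hw _).2.1 (hw _).2.2 _ (hQ ⟨j, hjJ⟩ _ α β h1 h2)
    · exact Or.inr hjJ

include hGood hStep hDescent in
/-- **`Ramakrishnan2000_boxTimes_cuspidal` (Ramakrishnan 2000, Theorem M for pairs of general
type) from the leaves of its printed proof** (§3.7, pp. 47–49): the good case (`hGood` — Thm. 3.5.1
with Prop. 3.2.1), the family of the induction step (`hStep` — Grunwald–Wang, Arthur–Clozel, (3.7.3),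
Lemma 3.7.5) and the descent criterion (`hDescent` — Prop. 3.6.1), for any goodness predicate and
rank function for which they hold (Ramakrishnan: §3.5 "good", `r(π) = (ℓ(π), p(π))` of (3.7.2)). The
a.e. statement of the fact is the strong form `exists_strongLift_of_leaves` weakened.
[cite: Ramakrishnan2000, Theorem M (§3), proof in §3.7 (preprint pp. 47–49)] -/
theorem Ramakrishnan2000_boxTimes_cuspidal.of_leaves : Ramakrishnan2000_boxTimes_cuspidal := by
  intro F _ _ hF hF4 π π' hdih htw
  obtain ⟨P, hP⟩ := Ramakrishnan2000_boxTimes_cuspidal.exists_strongLift_of_leaves Good rk hGood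
    hStep hDescent F hF hF4 π π' hdih htw
  exact ⟨P, Eventually.of_forall fun v α β hα hβ => hP v α β hα hβ⟩

include hDescent in
/-- **`Ramakrishnan2000_boxTimes_cuspidal` from three closed leaves** —
`Ramakrishnan2000_boxTimes_cuspidal.of_leaves` with Ramakrishnan's goodness predicate (§3.5, p. 41:
"Let `F` be a totally complex number field. We will call a pair `(π, π')` of cuspidal automorphic
representations of `GL(2, 𝔸_F)` *good* if at each finite place `v`, either `π_v` or `π'_v` is not
supercuspidal"; rendered by Mathlib's `NumberField.IsTotallyComplex` and, through the tree's local
components of a Borel–Jacquet datum (`AutomorphicRepData.HasLocalComponentAt` of `LocalComponentBJ`)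
and Harish-Chandra's `Representation.IsSupercuspidal` (`MatrixCoefficients`), "no finite place at
which both `π` and `π'` have a supercuspidal local component") and with the rank function
(`r(π) = (ℓ(π), p(π))` of (3.7.2), p. 47, refined by the bit "`F` not totally complex" for the case
`r = (0,1)`) quantified existentially inside the induction-step leaf (any well-founded strict
order). The three hypotheses are now closed statements: `hGood` = Thm. 3.5.1 with Prop. 3.2.1
(pp. 41–43, 18–21), `hStep` = the family of pp. 47–48 (Grunwald–Wang [AT, Ch. 10, Thm. 5],
Arthur–Clozel Ch. 3 Thm. 4.2 (a) / 5.1, (3.7.3), Lemma 3.7.5; for a good pair over a field that is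
not totally complex, the totally complex quadratic `K'(v_j)` of p. 47), `hDescent` = Prop. 3.6.1.
[cite: Ramakrishnan2000, Theorem M (§3), with §3.5 (p. 41) and §3.7 (preprint pp. 47–49)] -/
theorem Ramakrishnan2000_boxTimes_cuspidal.of_leaves'
    (hGood : ∀ (K : Type) [Field K] [NumberField K] (hK2 : isCompact_glFiniteIntegralLevel 2 K)
      (hK4 : isCompact_glFiniteIntegralLevel 4 K) (π π' : CuspidalAutomorphicRepData 2 K hK2),
      (∀ (E : Type) [Field E] [NumberField E] [Algebra K E], Module.finrank K E = 2 →
          ¬ IsQuadraticSelfTwistAE E π.1 ∧ ¬ IsQuadraticSelfTwistAE E π'.1) →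
      (∀ χ : GaloisRepresentations.HeckeCharacter K,
          ¬ ∀ᶠ v : HeightOneSpectrum (𝓞 K) in cofinite, ∀ α β : Multiset ℂ,
              π.1.HasSatakeParamAt v α → π'.1.HasSatakeParamAt v β →
                β = α.map (χ.valueAtUniformizer v * ·)) →
      IsTotallyComplex K →
      (∀ (v : HeightOneSpectrum (𝓞 K)) (πv π'v : SmoothIrrep (GL (Fin 2) (v.adicCompletion K))),
          π.1.HasLocalComponentAt v πv.ρ → π'.1.HasLocalComponentAt v π'v.ρ →
            ¬ πv.ρ.IsSupercuspidal ∨ ¬ π'v.ρ.IsSupercuspidal) →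
      ∃ P : CuspidalAutomorphicRepData 4 K hK4,
        ∀ (v : HeightOneSpectrum (𝓞 K)) (α β : Multiset ℂ), π.1.HasSatakeParamAt v α →
          π'.1.HasSatakeParamAt v β → P.1.HasSatakeParamAt v (satakeTensor α β))
    (hStep : ∃ (ρ₀ : Type) (_ : LT ρ₀) (_ : WellFoundedLT ρ₀)
        (rk : ∀ (K : Type) [Field K] [NumberField K] (hK2 : isCompact_glFiniteIntegralLevel 2 K),
          CuspidalAutomorphicRepData 2 K hK2 → CuspidalAutomorphicRepData 2 K hK2 → ρ₀),
      ∀ (K : Type) [Field K] [NumberField K] (hK2 : isCompact_glFiniteIntegralLevel 2 K)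
        (π π' : CuspidalAutomorphicRepData 2 K hK2),
        (∀ (E : Type) [Field E] [NumberField E] [Algebra K E], Module.finrank K E = 2 →
            ¬ IsQuadraticSelfTwistAE E π.1 ∧ ¬ IsQuadraticSelfTwistAE E π'.1) →
        (∀ χ : GaloisRepresentations.HeckeCharacter K,
            ¬ ∀ᶠ v : HeightOneSpectrum (𝓞 K) in cofinite, ∀ α β : Multiset ℂ,
                π.1.HasSatakeParamAt v α → π'.1.HasSatakeParamAt v β →
                  β = α.map (χ.valueAtUniformizer v * ·)) →
        ¬ (IsTotallyComplex K ∧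
            ∀ (v : HeightOneSpectrum (𝓞 K)) (πv π'v : SmoothIrrep (GL (Fin 2) (v.adicCompletion K))),
              π.1.HasLocalComponentAt v πv.ρ → π'.1.HasLocalComponentAt v π'v.ρ →
                ¬ πv.ρ.IsSupercuspidal ∨ ¬ π'v.ρ.IsSupercuspidal) →
        ∀ v : ℕ → HeightOneSpectrum (𝓞 K),
          (∀ j, π.1.IsUnramifiedAt (v j) ∧ π'.1.IsUnramifiedAt (v j)) →
        ∃ (p : ℕ) (J : Set ℕ) (E : J → Type) (_ : ∀ j, Field (E j)) (_ : ∀ j, NumberField (E j))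
          (_ : ∀ j, Algebra K (E j)) (hE2 : ∀ j : J, isCompact_glFiniteIntegralLevel 2 (E j))
          (πE π'E : ∀ j : J, CuspidalAutomorphicRepData 2 (E j) (hE2 j)),
          p.Prime ∧ Jᶜ.Finite ∧ (∀ j, IsGalois K (E j)) ∧ (∀ j, Module.finrank K (E j) = p) ∧
          (∀ j r, j ≠ r → IsEmpty (E j ≃ₐ[K] E r)) ∧
          (∀ j, rk (E j) (hE2 j) (πE j) (π'E j) < rk K hK2 π π') ∧
          (∀ (j : J) (E' : Type) [Field E'] [NumberField E'] [Algebra (E j) E'],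
            Module.finrank (E j) E' = 2 →
              ¬ IsQuadraticSelfTwistAE E' (πE j).1 ∧ ¬ IsQuadraticSelfTwistAE E' (π'E j).1) ∧
          (∀ (j : J) (χ : GaloisRepresentations.HeckeCharacter (E j)),
            ¬ ∀ᶠ w : HeightOneSpectrum (𝓞 (E j)) in cofinite, ∀ α β : Multiset ℂ,
                (πE j).1.HasSatakeParamAt w α → (π'E j).1.HasSatakeParamAt w β →
                  β = α.map (χ.valueAtUniformizer w * ·)) ∧
          (∀ (j : J) (w : HeightOneSpectrum (𝓞 (E j))) (u : HeightOneSpectrum (𝓞 K))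
              (α : Multiset ℂ), w.asIdeal.under (𝓞 K) = u.asIdeal → π.1.HasSatakeParamAt u α →
            (πE j).1.HasSatakeParamAt w (α.map (· ^ w.asIdeal.inertiaDeg (𝓞 K)))) ∧
          (∀ (j : J) (w : HeightOneSpectrum (𝓞 (E j))) (u : HeightOneSpectrum (𝓞 K))
              (β : Multiset ℂ), w.asIdeal.under (𝓞 K) = u.asIdeal → π'.1.HasSatakeParamAt u β →
            (π'E j).1.HasSatakeParamAt w (β.map (· ^ w.asIdeal.inertiaDeg (𝓞 K)))) ∧
          (∀ j : J, ∃ w : HeightOneSpectrum (𝓞 (E j)), w.asIdeal.under (𝓞 K) = (v j).asIdeal ∧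
            w.asIdeal.inertiaDeg (𝓞 K) = 1 ∧ w.asIdeal.ramificationIdx (𝓞 K) = 1)) :
    Ramakrishnan2000_boxTimes_cuspidal := by
  obtain ⟨ρ₀, _, _, rk₀, hStep₀⟩ := hStep
  exact Ramakrishnan2000_boxTimes_cuspidal.of_leaves
    (fun K _ _ hK2 π π' => IsTotallyComplex K ∧
      ∀ (v : HeightOneSpectrum (𝓞 K)) (πv π'v : SmoothIrrep (GL (Fin 2) (v.adicCompletion K))),
        π.1.HasLocalComponentAt v πv.ρ → π'.1.HasLocalComponentAt v π'v.ρ →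
          ¬ πv.ρ.IsSupercuspidal ∨ ¬ π'v.ρ.IsSupercuspidal)
    rk₀ (fun K _ _ hK2 hK4 π π' hdih htw hg => hGood K hK2 hK4 π π' hdih htw hg.1 hg.2) hStep₀
    hDescent

end Leaves

end Literature.NumberTheory.Automorphic

end
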